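import Literature.MathematicalPhysics.QuantumLattice.HubbardNNNHoppingEnergyDensityRegionBounds
import Literature.MathematicalPhysics.QuantumLattice.HubbardTTPrimeMeanEnergySupergradient
import Literature.MathematicalPhysics.QuantumLattice.HubbardTTPrimeEnergyDensityVariationalPrinciple
import HarnessLib

/-!
# Chemical-potential floors of the `t–t'` energy density: the grand-canonical coordinate `(t', U, μ)`
# of the certified region layer, its joint transport, and its completeness at every density

Family `hubbard` (topic `MathematicalPhysics/QuantumLattice`); written for stage S2 ("certifier
families": certified words over PARAMETER BOXES) of the Hubbard material oracle (D-0096/D-0097), seat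
`hubbard-box-p1` «joint concavity / Lipschitz in `(U, μ)` — the two-parameter tangent-plane lemma; box ⊂
union of certified cells ⇒ word». Companion of `HubbardNNNHoppingEnergyDensityRegionBounds` (regions of the
`(t', U)` half-plane at FIXED density) and `HubbardTTPrimeMeanEnergySupergradient` (tangent planes in
`(t', U)`). The object is the tree's thermodynamic-limit energy density
`e(t,t',U,n) = energyDensityTT' t t' U n` of `H(t,t',U) = -t T - t' T' + U D` on `ℤ²`.

The new coordinate is the CHEMICAL POTENTIAL. A **`μ`-floor** (grand-canonical floor) of `e` at the
couplings `(t, t', U)` is a pair `(c, μ)` with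

  `c + μ·m ≤ e(t, t', U, m)` for every density `0 ≤ m < 2`

— an affine minorant in the density, i.e. a lower bound `c ≤ inf_m (e(m) − μ m)` on the grand-canonical
ground-state energy per site at chemical potential `μ` (Ruelle 1969 §3.4: the canonical energy density is
convex in the density and the grand-canonical one is its Legendre transform). It is exactly what a
certificate of the translation-invariant-state relaxations certifies when the density row carries the
multiplier `μ` (§1: `μ`-floors ⇔ bounds `c + μ ρ(ω) ≤ e_Φ(ω)` for EVERY translation-invariant state `ω`,
`gcFloor_iff_forall_isTranslationInvariant`), and it is what the downfolding front end (stage S1) speaks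
when it hands over a material as a box in `(U, t', μ)`.

* §1 `gcFloor_iff_forall_isTranslationInvariant` — soundness and completeness of `μ`-floors against the
  variational principle (`IsTranslationInvariant.energyDensityTT'_le_meanEnergy`,
  `le_energyDensityTT'_iff_forall_isTranslationInvariant`).
* §2 JOINT TRANSPORT in `(t', U, μ)` ("joint concavity of the grand-canonical energy"): `μ`-floors
  `(cᵢ, μᵢ)` certified at anchors `(t'ᵢ, Uᵢ)`, `Uᵢ ≥ 0`, and convex weights `wᵢ` give the `μ`-floor
  `(Σ wᵢcᵢ, Σ wᵢμᵢ)` at the barycentre `(Σ wᵢt'ᵢ, Σ wᵢUᵢ)` — ONE inequality valid at EVERY density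
  (`energyDensityTT'_ge_sum_gcFloors`; two anchors `energyDensityTT'_ge_convexComb_gcFloors`; same anchor,
  two chemical potentials `gcFloor_convexComb_slopes`; the closed rectangle `[s₁,s₂] × [U₁,U₂]` with four
  corner floors `energyDensityTT'_box_ge_gcFloors` / `…_min_gcFloors`). This is the LOWER bound BETWEEN density
  anchors that convexity in the density alone never gives (between two densities convexity yields only the
  upper chord `energyDensityTT'_le_density_chord`; outward it yields `energyDensityTT'_ge_density_extrapolate_*`
  with a secant slope standing in for `μ`).
* §2b ONE-ANCHOR DRIFT (the Lipschitz constants of `RegionBounds` §4 in grand-canonical clothing — the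
  intercept `c` survives, the slope `μ` degrades): `(c, μ)` at `U₀` is a floor at every `U ≥ U₀`
  (`gcFloor_mono_U`); at `0 ≤ U ≤ U₀` the pair `(c, μ − (U₀ − U)/2)` is one (`gcFloor_of_le_U`, from
  `e(U₀,m) − (U₀−U)(m/2)² ≤ e(U,m)` and `(m/2)² ≤ m/2`); at another diagonal hopping `s'` the pair
  `(c, μ − 4|s' − s|)` is one (`gcFloor_of_tPrime`, from `|e(s,m) − e(s',m)| ≤ 4m|s − s'|`).
* §3 COMPLETENESS AT A POINT (Fenchel–Moreau for the convex `e(·)` on `[0,2)`): at every interior density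
  `0 < n < 2` some `μ`-floor is TIGHT, `c + μ n = e(t,t',U,n)` (`exists_gcFloor_eq`, the supporting line
  `exists_supporting_line_energyDensityTT'`): passing to the grand-canonical coordinate loses nothing. For
  states: every torus-limit ground state at density `n` is a GRAND-CANONICAL MINIMISER at such a `μ` — its
  `e_Φ(ω) − μ n` is below `e(m) − μ m` for every density `m` and below `e_Φ(ω') − μ ρ(ω')` for every
  translation-invariant `ω'` of density in `(0,2)` (`IsTorusLimitOf.exists_chemicalPotential`,
  `IsTorusLimitOf.exists_chemicalPotential_isTranslationInvariant`; the `t' ≠ 0` twin of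
  `exists_chemicalPotential_of_hubbardEnergyDensity_eq`).

How the box engine uses this file: a `(U, t', μ)`-cell product of stage S2 is a family of corner
`μ`-floors; §2 makes it a certified floor `e(t', U, n) ≥ c(t',U) + μ(t',U)·n` at every point of the cell
and EVERY density, §2b moves it to neighbouring cells without a new solve, §3 says the best such floor at
the material's density is the energy itself. The conjugate statements (density brackets from neighbouring
floors, the `(t', U, μ)` supergradient plane, monotonicity of `(D, A, ρ)` in `(U, t', μ)`, and the covering
rule "box ⊂ union of certified cells ⇒ one word") are in the companion file
`HubbardTTPrimeGrandCanonicalBrackets`. Everything is PROVED; no definition, no named fact, no numerical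
input.

## Mathlib / tree search

REUSED: `energyDensityTT'_ge_sum_lowerBounds`, `energyDensityTT'_ge_convexComb`, `energyDensityTT'_box_ge`,
`energyDensityTT'_box_ge_min`, `energyDensityTT'_mono_U`, `energyDensityTT'_ge_sub_mul_sq_U`,
`energyDensityTT'_tPrime_lipschitz_ge` (RegionBounds / Monotone), `exists_supporting_line_energyDensityTT'`
(Convex), `IsTranslationInvariant.energyDensityTT'_le_meanEnergy`,
`le_energyDensityTT'_iff_forall_isTranslationInvariant` (VariationalPrinciple),
`IsTorusLimitOf.meanEnergy_hubbardTTPrime_eq_energyDensityTT'`,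
`IsTorusLimitOf.energyDensityTT'_le_meanEnergy_hubbardTTPrime` (Supergradient / TorusLimitCorrelator).
`lean search 'chemicalPotential|gcFloor|supporting_line.*TT|Legendre.*energyDensity'`: only the `t' = 0`
`exists_chemicalPotential_of_hubbardEnergyDensity_eq` (for `hubbardEnergyDensity`, all densities incl. `0, 2`)
and the grand-canonical TORUS objects `hubbardTorusWith … μ` (`HubbardGrandCanonicalDensity*`, `t' = 0`,
Griffiths' lemma); nothing for `energyDensityTT'`.

## References

* D. Ruelle, *Statistical Mechanics: Rigorous Results* (1969), §3.4 (canonical versus grand-canonical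
  thermodynamic functions; convexity in the density, Legendre duality in `(ρ, μ)`). [cite: Ruelle1969, §3.4]
* R. B. Israel, *Convexity in the Theory of Lattice Gases* (1979), Thm. I.3.4 (the pressure is jointly
  convex and interaction-norm Lipschitz on the Banach space of interactions — here its `β → ∞` shadow for the
  four-parameter family `-t T - t' T' + U D - μ N`). [cite: Israel1979, Thm. I.3.4]
* R. B. Griffiths, Phys. Rev. 152 (1966) 240, §II (one-sided derivatives of a concave ground-state energy
  bound the conjugate observable). [cite: Griffiths1966, §II]
* O. Bratteli, A. Kishimoto, D. W. Robinson, Commun. Math. Phys. 64 (1978) 41, §3 Thm. 2 (translation-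
  invariant ground states minimise the mean energy). [cite: BratteliKishimotoRobinson1978, §3 Thm. 2]
-/

noncomputable section

namespace Literature.MathematicalPhysics.QuantumLattice

open Matrix Finset HubbardWave0 Literature.Probability.LatticeModels ThermodynamicLimit
open _root_.Filter
open scoped _root_.Topology ComplexOrder BigOperators

/-! ### §1 `μ`-floors are the bounds valid for every translation-invariant state -/

namespace InfVolFermionState

/-- **Soundness and completeness of `μ`-floors.** For `U ≥ 0` and reals `c, μ`: `c + μ m ≤ e(t,t',U,m)`
for every density `0 < m < 2` iff `c + μ ρ(ω) ≤ e^{tt'}(ω) = ω.meanEnergy (hubbardTTPrimeFermionInteraction t t' U) 1`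
for EVERY translation-invariant infinite-volume state `ω` on `ℤ²` with density `ρ(ω) ∈ (0,2)` — the
statement a translation-invariant-state relaxation certifies when its density row carries the multiplier
`μ` (→: the variational principle `IsTranslationInvariant.energyDensityTT'_le_meanEnergy`; ←: the bound is
attained at each density, `le_energyDensityTT'_iff_forall_isTranslationInvariant`). [cite: Ruelle1969, §3.4] -/
theorem gcFloor_iff_forall_isTranslationInvariant (t t' : ℝ) {U : ℝ} (hU : 0 ≤ U) (c μ : ℝ) :
    (∀ m : ℝ, 0 < m → m < 2 → c + μ * m ≤ energyDensityTT' t t' U m) ↔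
      ∀ ω : InfVolFermionState 2, ω.IsTranslationInvariant → 0 < ω.density → ω.density < 2 →
        c + μ * ω.density ≤ ω.meanEnergy (hubbardTTPrimeFermionInteraction t t' U) 1 := by
  constructor
  · intro h ω hω hρ0 hρ2
    exact (h ω.density hρ0 hρ2).trans (hω.energyDensityTT'_le_meanEnergy t t' hU hρ0 hρ2)
  · intro h m hm0 hm2
    exact (le_energyDensityTT'_iff_forall_isTranslationInvariant t t' hU hm0 hm2 (c + μ * m)).2
      fun ω hω hρ => by rw [← hρ]; exact h ω hω (hρ ▸ hm0) (hρ ▸ hm2)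

/-- **A `μ`-floor bounds the grand-canonical mean energy of every translation-invariant state from
below**: `c ≤ e^{tt'}(ω) − μ ρ(ω)` (`ρ(ω) ∈ (0,2)`). [cite: Ruelle1969, §3.4] -/
theorem IsTranslationInvariant.gcFloor_le_meanEnergy_sub {ω : InfVolFermionState 2}
    (hω : ω.IsTranslationInvariant) (t t' : ℝ) {U : ℝ} (hU : 0 ≤ U) {c μ : ℝ}
    (hc : ∀ m : ℝ, 0 ≤ m → m < 2 → c + μ * m ≤ energyDensityTT' t t' U m)
    (hρ0 : 0 < ω.density) (hρ2 : ω.density < 2) :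
    c ≤ ω.meanEnergy (hubbardTTPrimeFermionInteraction t t' U) 1 - μ * ω.density := by
  have h := (hc ω.density hρ0.le hρ2).trans (hω.energyDensityTT'_le_meanEnergy t t' hU hρ0 hρ2)
  linarith

end InfVolFermionState

/-! ### §2 Joint transport of `μ`-floors in `(t', U, μ)` -/

namespace ThermodynamicLimit

/-- **Barycentric transport of `μ`-floors (joint concavity in `(t', U, μ)`).** `μ`-floors `(cᵢ, μᵢ)` at
finitely many anchors `(t'ᵢ, Uᵢ)` with `Uᵢ ≥ 0` — `cᵢ + μᵢ m ≤ e(t, t'ᵢ, Uᵢ, m)` for all `0 ≤ m < 2` — and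
convex weights `wᵢ ≥ 0`, `Σ wᵢ = 1`, give at the barycentre, for EVERY density `0 ≤ n < 2`,
`Σ wᵢ cᵢ + (Σ wᵢ μᵢ)·n ≤ e(t, Σ wᵢ t'ᵢ, Σ wᵢ Uᵢ, n)`: the pair `(Σ wᵢcᵢ, Σ wᵢμᵢ)` is a `μ`-floor there
(Jensen for the jointly concave `(t',U) ↦ e` at fixed `n`, `energyDensityTT'_ge_sum_lowerBounds`, applied to
the affine-in-`n` anchor bounds). [cite: Israel1979, Thm. I.3.4] -/
theorem energyDensityTT'_ge_sum_gcFloors (t : ℝ) {ι : Type*} (s : Finset ι) (w tp U c μ : ι → ℝ)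
    (hw : ∀ i ∈ s, 0 ≤ w i) (hw1 : ∑ i ∈ s, w i = 1) (hU : ∀ i ∈ s, 0 ≤ U i)
    (hc : ∀ i ∈ s, ∀ m : ℝ, 0 ≤ m → m < 2 → c i + μ i * m ≤ energyDensityTT' t (tp i) (U i) m)
    {n : ℝ} (hn0 : 0 ≤ n) (hn2 : n < 2) :
    ∑ i ∈ s, w i * c i + (∑ i ∈ s, w i * μ i) * n ≤
      energyDensityTT' t (∑ i ∈ s, w i * tp i) (∑ i ∈ s, w i * U i) n := by
  have h := energyDensityTT'_ge_sum_lowerBounds t hn0 hn2 s w tp U (fun i => c i + μ i * n) hw hw1 hU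
    (fun i hi => hc i hi n hn0 hn2)
  have e : ∑ i ∈ s, w i * (c i + μ i * n) = ∑ i ∈ s, w i * c i + (∑ i ∈ s, w i * μ i) * n := by
    rw [Finset.sum_mul, ← Finset.sum_add_distrib]
    exact Finset.sum_congr rfl fun i _ => by ring
  rw [e] at h
  exact h

/-- **Two anchors.** `μ`-floors `(c₁, μ₁)` at `(s₁, U₁)` and `(c₂, μ₂)` at `(s₂, U₂)` (`U₁, U₂ ≥ 0`) and
weights `a, b ≥ 0`, `a + b = 1` give, for every `0 ≤ n < 2`,
`a c₁ + b c₂ + (a μ₁ + b μ₂) n ≤ e(t, a s₁ + b s₂, a U₁ + b U₂, n)`. [cite: Israel1979, Thm. I.3.4] -/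
theorem energyDensityTT'_ge_convexComb_gcFloors (t : ℝ) {s₁ s₂ U₁ U₂ a b c₁ c₂ μ₁ μ₂ : ℝ}
    (hU₁ : 0 ≤ U₁) (hU₂ : 0 ≤ U₂) (ha : 0 ≤ a) (hb : 0 ≤ b) (hab : a + b = 1)
    (hc₁ : ∀ m : ℝ, 0 ≤ m → m < 2 → c₁ + μ₁ * m ≤ energyDensityTT' t s₁ U₁ m)
    (hc₂ : ∀ m : ℝ, 0 ≤ m → m < 2 → c₂ + μ₂ * m ≤ energyDensityTT' t s₂ U₂ m)
    {n : ℝ} (hn0 : 0 ≤ n) (hn2 : n < 2) :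
    a * c₁ + b * c₂ + (a * μ₁ + b * μ₂) * n ≤
      energyDensityTT' t (a * s₁ + b * s₂) (a * U₁ + b * U₂) n := by
  have h := energyDensityTT'_ge_convexComb t hn0 hn2 hU₁ hU₂ ha hb hab (hc₁ n hn0 hn2) (hc₂ n hn0 hn2)
  linarith

/-- **Same anchor, two chemical potentials**: `μ`-floors `(c₁, μ₁)` and `(c₂, μ₂)` at the same couplings
and weights `a, b ≥ 0`, `a + b = 1` give the `μ`-floor `(a c₁ + b c₂, a μ₁ + b μ₂)` there (affine minorants
form a convex set; no hypothesis on the couplings). With §2 this is the transport over a full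
`(t', U, μ)`-cell from its corner floors. [cite: Ruelle1969, §3.4] -/
theorem gcFloor_convexComb_slopes {t t' U a b c₁ c₂ μ₁ μ₂ : ℝ} (ha : 0 ≤ a) (hb : 0 ≤ b)
    (hab : a + b = 1)
    (hc₁ : ∀ m : ℝ, 0 ≤ m → m < 2 → c₁ + μ₁ * m ≤ energyDensityTT' t t' U m)
    (hc₂ : ∀ m : ℝ, 0 ≤ m → m < 2 → c₂ + μ₂ * m ≤ energyDensityTT' t t' U m)
    {n : ℝ} (hn0 : 0 ≤ n) (hn2 : n < 2) :
    a * c₁ + b * c₂ + (a * μ₁ + b * μ₂) * n ≤ energyDensityTT' t t' U n := by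
  have h1 := mul_le_mul_of_nonneg_left (hc₁ n hn0 hn2) ha
  have h2 := mul_le_mul_of_nonneg_left (hc₂ n hn0 hn2) hb
  have e : a * energyDensityTT' t t' U n + b * energyDensityTT' t t' U n = energyDensityTT' t t' U n := by
    rw [← add_mul, hab, one_mul]
  nlinarith

/-- **The closed rectangle `[s₁, s₂] × [U₁, U₂]` of the `(t', U)` half-plane from its four corner
`μ`-floors** (`0 ≤ U₁`, `s₁ < s₂`, `U₁ < U₂`; floors `(cᵢⱼ, μᵢⱼ)` at `(sᵢ, Uⱼ)`): at every point `(s, U)` of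
the box and EVERY density `0 ≤ n < 2`, the bilinear interpolant of the four affine corner bounds
`cᵢⱼ + μᵢⱼ n` is below `e(t, s, U, n)` (`energyDensityTT'_box_ge` at each `n`). [cite: Israel1979, Thm. I.3.4] -/
theorem energyDensityTT'_box_ge_gcFloors (t : ℝ) {s₁ s₂ U₁ U₂ s U : ℝ}
    {c₁₁ c₁₂ c₂₁ c₂₂ μ₁₁ μ₁₂ μ₂₁ μ₂₂ : ℝ} (hU₁ : 0 ≤ U₁) (hs : s₁ < s₂) (hU : U₁ < U₂)
    (hs₁ : s₁ ≤ s) (hs₂ : s ≤ s₂) (hU₁' : U₁ ≤ U) (hU₂ : U ≤ U₂)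
    (h₁₁ : ∀ m : ℝ, 0 ≤ m → m < 2 → c₁₁ + μ₁₁ * m ≤ energyDensityTT' t s₁ U₁ m)
    (h₁₂ : ∀ m : ℝ, 0 ≤ m → m < 2 → c₁₂ + μ₁₂ * m ≤ energyDensityTT' t s₁ U₂ m)
    (h₂₁ : ∀ m : ℝ, 0 ≤ m → m < 2 → c₂₁ + μ₂₁ * m ≤ energyDensityTT' t s₂ U₁ m)
    (h₂₂ : ∀ m : ℝ, 0 ≤ m → m < 2 → c₂₂ + μ₂₂ * m ≤ energyDensityTT' t s₂ U₂ m)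
    {n : ℝ} (hn0 : 0 ≤ n) (hn2 : n < 2) :
    ((s₂ - s) * ((U₂ - U) * (c₁₁ + μ₁₁ * n) + (U - U₁) * (c₁₂ + μ₁₂ * n)) +
        (s - s₁) * ((U₂ - U) * (c₂₁ + μ₂₁ * n) + (U - U₁) * (c₂₂ + μ₂₂ * n))) /
          ((s₂ - s₁) * (U₂ - U₁)) ≤
      energyDensityTT' t s U n :=
  energyDensityTT'_box_ge t hn0 hn2 hU₁ hs hU hs₁ hs₂ hU₁' hU₂ (h₁₁ n hn0 hn2) (h₁₂ n hn0 hn2)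
    (h₂₁ n hn0 hn2) (h₂₂ n hn0 hn2)

/-- **Rectangle, min form**: with the data of `energyDensityTT'_box_ge_gcFloors`, the smallest of the four
affine corner bounds at density `n` is below `e(t, s, U, n)` on the whole closed box.
[cite: Israel1979, Thm. I.3.4] -/
theorem energyDensityTT'_box_ge_min_gcFloors (t : ℝ) {s₁ s₂ U₁ U₂ s U : ℝ}
    {c₁₁ c₁₂ c₂₁ c₂₂ μ₁₁ μ₁₂ μ₂₁ μ₂₂ : ℝ} (hU₁ : 0 ≤ U₁) (hs : s₁ < s₂) (hU : U₁ < U₂)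
    (hs₁ : s₁ ≤ s) (hs₂ : s ≤ s₂) (hU₁' : U₁ ≤ U) (hU₂ : U ≤ U₂)
    (h₁₁ : ∀ m : ℝ, 0 ≤ m → m < 2 → c₁₁ + μ₁₁ * m ≤ energyDensityTT' t s₁ U₁ m)
    (h₁₂ : ∀ m : ℝ, 0 ≤ m → m < 2 → c₁₂ + μ₁₂ * m ≤ energyDensityTT' t s₁ U₂ m)
    (h₂₁ : ∀ m : ℝ, 0 ≤ m → m < 2 → c₂₁ + μ₂₁ * m ≤ energyDensityTT' t s₂ U₁ m)
    (h₂₂ : ∀ m : ℝ, 0 ≤ m → m < 2 → c₂₂ + μ₂₂ * m ≤ energyDensityTT' t s₂ U₂ m)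
    {n : ℝ} (hn0 : 0 ≤ n) (hn2 : n < 2) :
    min (min (c₁₁ + μ₁₁ * n) (c₁₂ + μ₁₂ * n)) (min (c₂₁ + μ₂₁ * n) (c₂₂ + μ₂₂ * n)) ≤
      energyDensityTT' t s U n :=
  energyDensityTT'_box_ge_min t hn0 hn2 hU₁ hs hU hs₁ hs₂ hU₁' hU₂ (h₁₁ n hn0 hn2) (h₁₂ n hn0 hn2)
    (h₂₁ n hn0 hn2) (h₂₂ n hn0 hn2)

/-! ### §2b One-anchor drift: the intercept survives, the chemical potential degrades -/

/-- **Upward in `U` a `μ`-floor is free**: `(c, μ)` at `U₀ ≥ 0` is a `μ`-floor at every `U ≥ U₀` (the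
energy density is non-decreasing in `U`, `energyDensityTT'_mono_U`). [cite: Ruelle1969, §3.4] -/
theorem gcFloor_mono_U (t t' : ℝ) {U₀ U c μ : ℝ} (hU₀ : 0 ≤ U₀) (hle : U₀ ≤ U)
    (hc : ∀ m : ℝ, 0 ≤ m → m < 2 → c + μ * m ≤ energyDensityTT' t t' U₀ m)
    {n : ℝ} (hn0 : 0 ≤ n) (hn2 : n < 2) :
    c + μ * n ≤ energyDensityTT' t t' U n :=
  (hc n hn0 hn2).trans (energyDensityTT'_mono_U t t' hn0 hn2 hU₀ hle)

/-- **Downward in `U` the slope drops by half the step**: a `μ`-floor `(c, μ)` at `U₀` gives the `μ`-floor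
`(c, μ − (U₀ − U)/2)` at every `0 ≤ U ≤ U₀` — from `e(U₀, m) − (U₀ − U)(m/2)² ≤ e(U, m)`
(`energyDensityTT'_ge_sub_mul_sq_U`: the double-occupancy density never exceeds `(m/2)²`) and
`(m/2)² ≤ m/2` on `[0, 2)`. [cite: BachLiebSolovej1994, eq. (2c.36)] -/
theorem gcFloor_of_le_U (t t' : ℝ) {U₀ U c μ : ℝ} (hU : 0 ≤ U) (hle : U ≤ U₀)
    (hc : ∀ m : ℝ, 0 ≤ m → m < 2 → c + μ * m ≤ energyDensityTT' t t' U₀ m)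
    {n : ℝ} (hn0 : 0 ≤ n) (hn2 : n < 2) :
    c + (μ - (U₀ - U) / 2) * n ≤ energyDensityTT' t t' U n := by
  have h1 := energyDensityTT'_ge_sub_mul_sq_U t t' hn0 hn2 hU hle
  have h2 := hc n hn0 hn2
  have hsq : (n / 2) ^ 2 ≤ n / 2 := by nlinarith
  nlinarith [mul_le_mul_of_nonneg_left hsq (sub_nonneg.2 hle)]

/-- **Across `t'` the slope drops by `4|Δt'|`**: a `μ`-floor `(c, μ)` at diagonal hopping `s` (`U ≥ 0`)
gives the `μ`-floor `(c, μ − 4|s' − s|)` at every `s'` (`e(s, m) − 4m|s' − s| ≤ e(s', m)`,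
`energyDensityTT'_tPrime_lipschitz_ge`: the diagonal band costs at most `4|t'|` per particle).
[cite: Israel1979, Thm. I.3.4] -/
theorem gcFloor_of_tPrime (t : ℝ) {U : ℝ} (hU : 0 ≤ U) {s s' c μ : ℝ}
    (hc : ∀ m : ℝ, 0 ≤ m → m < 2 → c + μ * m ≤ energyDensityTT' t s U m)
    {n : ℝ} (hn0 : 0 ≤ n) (hn2 : n < 2) :
    c + (μ - 4 * |s' - s|) * n ≤ energyDensityTT' t s' U n := by
  have h1 := energyDensityTT'_tPrime_lipschitz_ge t hU hn0 hn2 s s'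
  have h2 := hc n hn0 hn2
  nlinarith [abs_nonneg (s' - s)]

/-- **Drift in both directions at once**: a `μ`-floor `(c, μ)` at `(s, U₀)` gives the `μ`-floor
`(c, μ − 4|s' − s| − max (U₀ − U) 0 / 2)` at every `(s', U)` with `U ≥ 0` (upward in `U` free, downward at
slope cost `(U₀ − U)/2`, sideways at slope cost `4|s' − s|`) — ONE certificate covers a whole
neighbourhood of its anchor at every density, with an explicit, density-linear loss.
[cite: Israel1979, Thm. I.3.4] -/
theorem gcFloor_drift (t : ℝ) {U₀ U s s' c μ : ℝ} (hU₀ : 0 ≤ U₀) (hU : 0 ≤ U)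
    (hc : ∀ m : ℝ, 0 ≤ m → m < 2 → c + μ * m ≤ energyDensityTT' t s U₀ m)
    {n : ℝ} (hn0 : 0 ≤ n) (hn2 : n < 2) :
    c + (μ - 4 * |s' - s| - max (U₀ - U) 0 / 2) * n ≤ energyDensityTT' t s' U n := by
  -- first move in `U` at fixed `s`, then in `t'` at fixed `U`
  have hU' : ∀ m : ℝ, 0 ≤ m → m < 2 → c + (μ - max (U₀ - U) 0 / 2) * m ≤ energyDensityTT' t s U m := by
    intro m hm0 hm2
    rcases le_total U U₀ with hle | hle
    · rw [max_eq_left (sub_nonneg.2 hle)]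
      exact gcFloor_of_le_U t s hU hle hc hm0 hm2
    · rw [max_eq_right (sub_nonpos.2 hle), zero_div, sub_zero]
      exact gcFloor_mono_U t s hU₀ hle hc hm0 hm2
  have h := gcFloor_of_tPrime t hU (s := s) (s' := s') hU' hn0 hn2
  have e : μ - max (U₀ - U) 0 / 2 - 4 * |s' - s| = μ - 4 * |s' - s| - max (U₀ - U) 0 / 2 := by ring
  rw [e] at h
  exact h

/-! ### §3 Completeness at a point: a tight `μ`-floor at every interior density -/

/-- **Fenchel–Moreau at a density.** For `U ≥ 0` and every interior density `0 < n < 2` there is a TIGHT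
`μ`-floor: reals `μ, c` with `c + μ m ≤ e(t,t',U,m)` for all `0 ≤ m < 2` and `c + μ n = e(t,t',U,n)`
(`μ` = any supporting slope of the convex `e(·)` at `n`, `exists_supporting_line_energyDensityTT'`;
`c = e(n) − μ n`). Hence `e(t,t',U,n) = max over μ-floors of (c + μ n)`: the canonical energy at the
material's density is recovered exactly from grand-canonical certificates. [cite: Ruelle1969, §3.4] -/
theorem exists_gcFloor_eq (t t' : ℝ) {U : ℝ} (hU : 0 ≤ U) {n : ℝ} (hn0 : 0 < n) (hn2 : n < 2) :
    ∃ μ c : ℝ, (∀ m : ℝ, 0 ≤ m → m < 2 → c + μ * m ≤ energyDensityTT' t t' U m) ∧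
      c + μ * n = energyDensityTT' t t' U n := by
  obtain ⟨s, hs⟩ := exists_supporting_line_energyDensityTT' t t' hU hn0 hn2
  refine ⟨s, energyDensityTT' t t' U n - s * n, fun m hm0 hm2 => ?_, by ring⟩
  have h := hs m ⟨hm0, hm2⟩
  linarith

/-- **The supporting slope is a chemical potential**: with `μ, c` as in `exists_gcFloor_eq`,
`e(n) − μ n ≤ e(m) − μ m` for every density `0 ≤ m < 2` — density `n` minimises the grand-canonical
energy `e(m) − μ m`. [cite: Ruelle1969, §3.4] -/
theorem exists_chemicalPotential_energyDensityTT' (t t' : ℝ) {U : ℝ} (hU : 0 ≤ U) {n : ℝ} (hn0 : 0 < n)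
    (hn2 : n < 2) :
    ∃ μ : ℝ, ∀ m : ℝ, 0 ≤ m → m < 2 →
      energyDensityTT' t t' U n - μ * n ≤ energyDensityTT' t t' U m - μ * m := by
  obtain ⟨μ, c, hc, hcn⟩ := exists_gcFloor_eq t t' hU hn0 hn2
  refine ⟨μ, fun m hm0 hm2 => ?_⟩
  have h := hc m hm0 hm2
  linarith

end ThermodynamicLimit

namespace InfVolFermionState

/-- **Every torus-limit ground state is a grand-canonical minimiser.** Let `ω` be a torus limit along
`Ls → ∞` of unit ground states `ψ_j` of `hubbardTorusTT' (Ls j) t t' U` in the sectors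
`(rectN n (Ls j), S^z = 0)`, `U ≥ 0`, `0 < n < 2`. Then for some chemical potential `μ` (any supporting
slope at `n`): `e^{tt'}(ω) − μ n ≤ e(t,t',U,m) − μ m` for every density `0 ≤ m < 2`
(`e^{tt'}(ω) = e(t,t',U,n)`, `IsTorusLimitOf.meanEnergy_hubbardTTPrime_eq_energyDensityTT'`, and
`exists_chemicalPotential_energyDensityTT'`). [cite: BratteliKishimotoRobinson1978, §3 Thm. 2] -/
theorem IsTorusLimitOf.exists_chemicalPotential (t t' : ℝ) {U : ℝ} (hU : 0 ≤ U) {n : ℝ}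
    (hn0 : 0 < n) (hn2 : n < 2)
    {ω : InfVolFermionState 2} {ψ : ∀ L, Fock (Orb (FermionTorus 2 L))} {Ls : ℕ → ℕ}
    (h : ω.IsTorusLimitOf ψ Ls) (hLs : Tendsto Ls atTop atTop)
    (hψ : ∀ j, IsGroundStateInSector (hubbardTorusTT' (Ls j) t t' U) (rectN n (Ls j)) 0 (ψ (Ls j)))
    (h1 : ∀ j, star (ψ (Ls j)) ⬝ᵥ ψ (Ls j) = 1) :
    ∃ μ : ℝ, ∀ m : ℝ, 0 ≤ m → m < 2 →
      ω.meanEnergy (hubbardTTPrimeFermionInteraction t t' U) 1 - μ * n ≤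
        energyDensityTT' t t' U m - μ * m := by
  rw [h.meanEnergy_hubbardTTPrime_eq_energyDensityTT' t t' hU hn0.le hn2 hLs hψ h1]
  exact exists_chemicalPotential_energyDensityTT' t t' hU hn0 hn2

/-- **… and below every translation-invariant state**: with the same data and `μ`,
`e^{tt'}(ω) − μ n ≤ e^{tt'}(ω') − μ ρ(ω')` for every translation-invariant `ω'` on `ℤ²` of density
`ρ(ω') ∈ (0,2)` (the variational principle at density `ρ(ω')`); and `ρ(ω) = n`
(`IsTorusLimitOf.density_eq_of_rectN`). The `t–t'` twin of `exists_chemicalPotential_of_hubbardEnergyDensity_eq`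
on the open density interval. [cite: BratteliKishimotoRobinson1978, §3 Thm. 2] -/
theorem IsTorusLimitOf.exists_chemicalPotential_isTranslationInvariant (t t' : ℝ) {U : ℝ} (hU : 0 ≤ U)
    {n : ℝ} (hn0 : 0 < n) (hn2 : n < 2)
    {ω : InfVolFermionState 2} {ψ : ∀ L, Fock (Orb (FermionTorus 2 L))} {Ls : ℕ → ℕ}
    (h : ω.IsTorusLimitOf ψ Ls) (hLs : Tendsto Ls atTop atTop)
    (hψ : ∀ j, IsGroundStateInSector (hubbardTorusTT' (Ls j) t t' U) (rectN n (Ls j)) 0 (ψ (Ls j)))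
    (h1 : ∀ j, star (ψ (Ls j)) ⬝ᵥ ψ (Ls j) = 1) :
    ω.density = n ∧ ∃ μ : ℝ, ∀ ω' : InfVolFermionState 2, ω'.IsTranslationInvariant →
      0 < ω'.density → ω'.density < 2 →
        ω.meanEnergy (hubbardTTPrimeFermionInteraction t t' U) 1 - μ * n ≤
          ω'.meanEnergy (hubbardTTPrimeFermionInteraction t t' U) 1 - μ * ω'.density := by
  have hN : ∀ j, IsNParticle (rectN n (Ls j)) (ψ (Ls j)) := fun j =>
    ((mem_szSector_iff _ _ _).1 (hψ j).1).1
  refine ⟨h.density_eq_of_rectN hLs hn0.le hN h1, ?_⟩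
  obtain ⟨μ, hμ⟩ := h.exists_chemicalPotential t t' hU hn0 hn2 hLs hψ h1
  refine ⟨μ, fun ω' hω' hρ0 hρ2 => ?_⟩
  have h2 := hω'.energyDensityTT'_le_meanEnergy t t' hU hρ0 hρ2
  have h3 := hμ ω'.density hρ0.le hρ2
  linarith

end InfVolFermionState

end Literature.MathematicalPhysics.QuantumLattice

end
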